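import Summits.AtomisticToContinuum.HydrodynamicLimit.Theorems.RelayRaceLocalityNearConstantShortTimeHLTorusCells
import Literature.Analysis.FluidPDE.ConfinedHardSphereFlowShortBad
import HarnessLib

/-!
# Crux `LightConeInLaw` (stmt-AtomisticToContinuum-12500), line `count-sufficiency-reduction` — stub `stub_chargedAtoms`, part A: the charged set

Support file (`--supports stmt-AtomisticToContinuum-12500`, route `RelayRaceLocality`) for the
registered statics stub `stub_chargedAtoms` (every count atom near the centre is charged by gas 1)
of the lead's skeleton `Cruxes/LightConeInLaw/Lines/count_sufficiency_reduction.lean`: the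
elementary PACKING LEMMA behind it, registered as `chargedSet`. Given a mesh `1/L` with
`ε ≤ (2L)⁻¹`, a ball `B(x₀, R')` and integers `k ≤ n` with
`k ≤ L³ vol B(x₀, R' - 2/L)` and `n - k ≤ L³ vol {dist(·, x₀) > R' + 2/L}`, there is a measurable
set of positive Haar volume of position configurations `x : Fin n → 𝕋³` whose points are pairwise
at minimal-image distance `≥ ε` with exactly `k` of them in the open ball `B(x₀, R')`; plus the two
analytic tools of the count window (`mesh_spec`, `exists_shrink`).

Construction (chessboard cells of `…NearConstantShortTimeHLTorusCells`): the blocks of mesh `1/L`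
(cells `{gridIndex L (repr y) = b}`, volume `L⁻³`, minimal-image diameter `≤ √3/L ≤ 2/L`) meeting
`B(x₀, R' - 2/L)` lie inside the ball and number `≥ L³ vol B(x₀, R' - 2/L)` (they cover it);
likewise the blocks meeting `{dist > R' + 2/L}` lie in the exterior. Assign to particle `i < k` the
`i`-th ball block and to particle `i ≥ k` the `(i-k)`-th exterior block (injectively), and let each
particle range over the ALL-EVEN sub-cell of mesh `1/(2L)` of its block: distinct all-even cells are
`> (2L)⁻¹ ≥ ε` apart (`torus_cells_separation`), so the product of these cells (volume
`(2L)^{-3n} > 0`) is the required set. Elementary; no definitions, no named facts.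
-/

namespace Summit.AtomisticToContinuum.HydrodynamicLimit.Theorems.LightConeInLawCSR.ChargedAtoms

open scoped BigOperators Topology Classical ENNReal
open Filter Set MeasureTheory
open Literature.MathematicalPhysics.KineticTheory Literature.Analysis.FluidPDE
open Literature.Analysis.FunctionSpaces
open Summit.AtomisticToContinuum.HydrodynamicLimit.Theorems.NearConstantShortTimeHL

noncomputable section

/-! ## Blocks of mesh `1/L`: diameter, even sub-cells, counting by volume -/

/-- Blocks of mesh `1/L` (cells `{gridIndex L (repr y) = b}`) have minimal-image diameter at most
`2/L` (`√3 ≤ 2`). -/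
theorem euclidDist_le_of_gridIndex_eq {L : ℕ} (hL : 0 < L) {b : Fin 3 → Fin L} {y y' : T3}
    (hy : Torus.gridIndex L (Torus.repr y) = Torus.finIndex b)
    (hy' : Torus.gridIndex L (Torus.repr y') = Torus.finIndex b) : Torus.euclidDist y y' ≤ 2 / L := by
  have h3 := Torus.norm_sub_le_of_mem_gridCell hL ((Torus.mem_gridCell_iff_gridIndex_eq hL).2 hy)
    ((Torus.mem_gridCell_iff_gridIndex_eq hL).2 hy')
  have h4 : Torus.euclidDist (Torus.proj (Torus.repr y)) (Torus.proj (Torus.repr y')) ≤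
      ‖Torus.repr y - Torus.repr y'‖ := Torus.euclidDist_proj_le_norm_sub_holds _ _
  rw [Torus.proj_repr, Torus.proj_repr] at h4
  have h5 : Real.sqrt (Fintype.card (Fin 3)) ≤ 2 := by
    rw [Fintype.card_fin, Real.sqrt_le_left (by norm_num)]
    norm_num
  calc Torus.euclidDist y y' ≤ ‖Torus.repr y - Torus.repr y'‖ := h4
    _ ≤ Real.sqrt (Fintype.card (Fin 3)) / L := h3
    _ ≤ 2 / L := by gcongr

/-- The cell of mesh `1/(2L)` with doubled index `j = 2b` lies in the block `b` of mesh `1/L`. -/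
theorem gridIndex_eq_of_double {L : ℕ} {b : Fin 3 → Fin L} {j : Fin 3 → Fin (2 * L)}
    (hj : ∀ i, ((j i : ℕ) : ℝ) = 2 * ((b i : ℕ) : ℝ)) {y : T3}
    (hy : Torus.gridIndex (2 * L) (Torus.repr y) = Torus.finIndex j) :
    Torus.gridIndex L (Torus.repr y) = Torus.finIndex b := by
  funext i
  have h := cell_coord hy i
  rw [hj i, show (((2 * L : ℕ)) : ℝ) = 2 * (L : ℝ) by push_cast; ring] at h
  rw [Torus.gridIndex_apply, Torus.finIndex_apply, Int.floor_eq_iff]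
  push_cast
  constructor
  · linarith [h.1]
  · linarith [h.2]

/-- Counting blocks from below by a volume: `L³ · vol(A) ≤ #J` whenever every point of `A` lies in
a block of `J` (the blocks partition `𝕋³` into sets of volume `L⁻³`). -/
theorem pow_mul_toReal_le_card {L : ℕ} (hL : 0 < L) {A : Set T3} {J : Finset (Fin 3 → Fin L)}
    (hA : ∀ y ∈ A, ∀ b : Fin 3 → Fin L, Torus.gridIndex L (Torus.repr y) = Torus.finIndex b → b ∈ J) :
    (L : ℝ) ^ 3 * (volume A).toReal ≤ J.card := by
  have hsub : A ⊆ ⋃ b ∈ J, {y : T3 | Torus.gridIndex L (Torus.repr y) = Torus.finIndex b} := by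
    intro y hy
    obtain ⟨b, hb, -⟩ := existsUnique_cell hL y
    exact mem_iUnion₂.2 ⟨b, hA y hy b hb, hb⟩
  have hL0 : (L : ℝ≥0∞) ≠ 0 := by exact_mod_cast hL.ne'
  have h1 : volume A ≤ J.card * ((L : ℝ≥0∞)⁻¹) ^ 3 :=
    calc volume A ≤ volume (⋃ b ∈ J, {y : T3 | Torus.gridIndex L (Torus.repr y) = Torus.finIndex b}) :=
          measure_mono hsub
      _ ≤ ∑ b ∈ J, volume {y : T3 | Torus.gridIndex L (Torus.repr y) = Torus.finIndex b} :=
          measure_biUnion_finset_le _ _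
      _ = ∑ b ∈ J, ((L : ℝ≥0∞)⁻¹) ^ 3 := Finset.sum_congr rfl fun b _ => volume_cell hL b
      _ = J.card * ((L : ℝ≥0∞)⁻¹) ^ 3 := by rw [Finset.sum_const, nsmul_eq_mul]
  have h2 : (L : ℝ≥0∞) ^ 3 * volume A ≤ J.card :=
    calc (L : ℝ≥0∞) ^ 3 * volume A ≤ (L : ℝ≥0∞) ^ 3 * (J.card * ((L : ℝ≥0∞)⁻¹) ^ 3) := by
          gcongr
      _ = J.card * ((L : ℝ≥0∞) * (L : ℝ≥0∞)⁻¹) ^ 3 := by rw [mul_pow]; ring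
      _ = J.card := by rw [ENNReal.mul_inv_cancel hL0 (ENNReal.natCast_ne_top L), one_pow, mul_one]
  have h3 := ENNReal.toReal_mono (ENNReal.natCast_ne_top _) h2
  rw [ENNReal.toReal_mul, ENNReal.toReal_pow, ENNReal.toReal_natCast, ENNReal.toReal_natCast] at h3
  exact h3

/-- `#{i : Fin n | i < k} = k` for `k ≤ n`. -/
theorem card_filter_val_lt {n k : ℕ} (hkn : k ≤ n) :
    (Finset.univ.filter fun i : Fin n => (i : ℕ) < k).card = k := by
  have h : (Finset.univ.filter fun i : Fin n => (i : ℕ) < k) =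
      Finset.univ.map (Fin.castLEEmb hkn) := by
    ext i
    simp only [Finset.mem_filter, Finset.mem_univ, true_and, Finset.mem_map]
    exact ⟨fun hi => ⟨⟨i, hi⟩, Fin.ext rfl⟩, fun ⟨j, hj⟩ => hj ▸ j.isLt⟩
  rw [h, Finset.card_map, Finset.card_univ, Fintype.card_fin]

/-! ## The charged configuration set -/

/-- **The charged set, combinatorial form.** Let `ε ≤ (2L)⁻¹`, `k ≤ n`, and let `J₁`, `J₂` be two
disjoint families of blocks of mesh `1/L`, those of `J₁` inside `B(x₀, R')`, those of `J₂` inside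
`{dist(·, x₀) > R'}`, with `k ≤ #J₁`, `n - k ≤ #J₂`. Then a measurable set of position
configurations of positive volume has its points pairwise `≥ ε` apart with exactly `k` of them in
`B(x₀, R')`: particle `i < k` ranges over the all-even cell (mesh `1/(2L)`) of the `i`-th block of
`J₁`, particle `i ≥ k` over that of the `(i-k)`-th block of `J₂`. -/
theorem exists_chargedSet {L n k : ℕ} (hL : 0 < L) {ε : ℝ} (hε : ε ≤ ((2 * L : ℕ) : ℝ)⁻¹)
    (x₀ : T3) (R' : ℝ) {J₁ J₂ : Finset (Fin 3 → Fin L)}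
    (hJ₁ : ∀ b ∈ J₁, ∀ y : T3, Torus.gridIndex L (Torus.repr y) = Torus.finIndex b →
      Torus.euclidDist y x₀ < R')
    (hJ₂ : ∀ b ∈ J₂, ∀ y : T3, Torus.gridIndex L (Torus.repr y) = Torus.finIndex b →
      R' < Torus.euclidDist y x₀)
    (hJ : ∀ b ∈ J₁, b ∉ J₂) (hkn : k ≤ n) (hkB : k ≤ J₁.card) (hkE : n - k ≤ J₂.card) :
    ∃ T : Set (Fin n → T3), MeasurableSet T ∧ volume T ≠ 0 ∧
      T ⊆ {x | (∀ i j, i ≠ j → ε ≤ Torus.euclidDist (x i) (x j)) ∧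
        (Finset.univ.filter fun i : Fin n => Torus.euclidDist (x i) x₀ < R').card = k} := by
  obtain ⟨eB⟩ : Nonempty (Fin k ↪ {b // b ∈ J₁}) :=
    Function.Embedding.nonempty_of_card_le (by simpa using hkB)
  obtain ⟨eE⟩ : Nonempty (Fin (n - k) ↪ {b // b ∈ J₂}) :=
    Function.Embedding.nonempty_of_card_le (by simpa using hkE)
  -- assignment of blocks to particles
  set c : Fin n → (Fin 3 → Fin L) := fun i =>
    if h : (i : ℕ) < k then (eB ⟨i, h⟩).1 else (eE ⟨i - k, by omega⟩).1 with hc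
  have hcB : ∀ i : Fin n, (i : ℕ) < k → c i ∈ J₁ := fun i hi => by
    simp only [hc, dif_pos hi]
    exact (eB ⟨i, hi⟩).2
  have hcE : ∀ i : Fin n, ¬ (i : ℕ) < k → c i ∈ J₂ := fun i hi => by
    simp only [hc, dif_neg hi]
    exact (eE ⟨i - k, by omega⟩).2
  have hcinj : Function.Injective c := by
    intro i j hij
    by_cases hi : (i : ℕ) < k <;> by_cases hj : (j : ℕ) < k
    · have h1 : c i = (eB ⟨i, hi⟩).1 := by simp only [hc, dif_pos hi]
      have h2 : c j = (eB ⟨j, hj⟩).1 := by simp only [hc, dif_pos hj]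
      have h3 := eB.injective (Subtype.ext (h1.symm.trans (hij.trans h2)))
      exact Fin.ext (Fin.mk.inj_iff.1 h3)
    · exact (hJ _ (hcB i hi) (hij ▸ hcE j hj)).elim
    · exact (hJ _ (hcB j hj) (hij ▸ hcE i hi)).elim
    · have h1 : c i = (eE ⟨i - k, by omega⟩).1 := by simp only [hc, dif_neg hi]
      have h2 : c j = (eE ⟨j - k, by omega⟩).1 := by simp only [hc, dif_neg hj]
      have h3 := Fin.mk.inj_iff.1 (eE.injective (Subtype.ext (h1.symm.trans (hij.trans h2))))
      exact Fin.ext (by omega)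
  -- doubled indices: the all-even cells of mesh `1/(2L)`
  obtain ⟨d, hd⟩ : ∃ d : (Fin 3 → Fin L) → (Fin 3 → Fin (2 * L)),
      ∀ b i, ((d b i : Fin (2 * L)) : ℕ) = 2 * (b i : ℕ) :=
    ⟨fun b i => ⟨2 * (b i : ℕ), by have := (b i).isLt; omega⟩, fun b i => rfl⟩
  have hd' : ∀ b i, (((d b i : Fin (2 * L)) : ℕ) : ℝ) = 2 * ((b i : ℕ) : ℝ) := fun b i => by
    rw [hd]; push_cast; ring
  have hdinj : ∀ b b', d b = d b' → b = b' := fun b b' h => funext fun i => Fin.ext (by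
    have := congrArg (fun f : Fin 3 → Fin (2 * L) => ((f i : Fin (2 * L)) : ℕ)) h
    simp only [hd] at this
    omega)
  have h2L : 0 < 2 * L := by omega
  refine ⟨Set.pi univ fun i => {y | Torus.gridIndex (2 * L) (Torus.repr y) = Torus.finIndex (d (c i))},
    MeasurableSet.univ_pi fun i => measurableSet_cell h2L _, ?_, ?_⟩
  · rw [volume_pi_pi]
    refine Finset.prod_ne_zero_iff.2 fun i _ => ?_
    rw [volume_cell h2L]
    exact pow_ne_zero _ (ENNReal.inv_ne_zero.2 (ENNReal.natCast_ne_top _))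
  · intro x hx
    have hxi : ∀ i, Torus.gridIndex (2 * L) (Torus.repr (x i)) = Torus.finIndex (d (c i)) :=
      fun i => hx i (mem_univ i)
    refine ⟨fun i j hij => ?_, ?_⟩
    · have hne : d (c i) ≠ d (c j) := fun h => hij (hcinj (hdinj _ _ h))
      have hsep := torus_cells_separation (2 * L) h2L (even_two_mul L) (d (c i)) (d (c j)) hne
        (fun l => by rw [hd, hd]; simp [Nat.mul_mod_right]) (x i) (x j) (hxi i) (hxi j)
      exact hε.trans hsep.le
    · have hfilt : (Finset.univ.filter fun i : Fin n => Torus.euclidDist (x i) x₀ < R') =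
          Finset.univ.filter fun i : Fin n => (i : ℕ) < k := by
        refine Finset.filter_congr fun i _ => ?_
        by_cases hi : (i : ℕ) < k
        · simp only [hi, iff_true]
          exact hJ₁ _ (hcB i hi) _ (gridIndex_eq_of_double (hd' (c i)) (hxi i))
        · simp only [hi, iff_false, not_lt]
          exact (hJ₂ _ (hcE i hi) _ (gridIndex_eq_of_double (hd' (c i)) (hxi i))).le
      rw [hfilt, card_filter_val_lt hkn]

/-- **The charged set (packing lemma; registered helper of `stub_chargedAtoms`).** For a mesh
`1/L`, `0 < L`, a diameter `ε ≤ (2L)⁻¹`, a ball `B(x₀, R')` and integers `k ≤ n` with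
`k ≤ L³ · vol B(x₀, R' - 2/L)` and `n - k ≤ L³ · vol {dist(·, x₀) > R' + 2/L}`, there is a
measurable set of positive volume of configurations `x : Fin n → 𝕋³` pairwise at minimal-image
distance `≥ ε` with exactly `k` points in the open ball `B(x₀, R')`: the blocks meeting the
shrunken ball (exterior) lie in the ball (exterior) by the triangle inequality and cover it, so they
number at least `L³` times its volume; then `exists_chargedSet`. -/
theorem chargedSet : ∀ {L n k : ℕ}, 0 < L → ∀ {ε : ℝ}, ε ≤ ((2 * L : ℕ) : ℝ)⁻¹ → ∀ (x₀ : T3) (R' : ℝ), k ≤ n → (k : ℝ) ≤ (L : ℝ) ^ 3 * (volume {y : T3 | Torus.euclidDist y x₀ < R' - 2 / L}).toReal → (n : ℝ) - k ≤ (L : ℝ) ^ 3 * (volume {y : T3 | R' + 2 / L < Torus.euclidDist y x₀}).toReal → ∃ T : Set (Fin n → T3), MeasurableSet T ∧ volume T ≠ 0 ∧ T ⊆ {x | (∀ i j, i ≠ j → ε ≤ Torus.euclidDist (x i) (x j)) ∧ (Finset.univ.filter fun i : Fin n => Torus.euclidDist (x i) x₀ < R').card = k} := by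
  intro L n k hL ε hε x₀ R' hkn hkB hkE
  -- the blocks meeting the shrunken ball / the shrunken exterior
  set J₁ : Finset (Fin 3 → Fin L) := Finset.univ.filter fun b => ∃ y : T3,
    Torus.gridIndex L (Torus.repr y) = Torus.finIndex b ∧ Torus.euclidDist y x₀ < R' - 2 / L with hJ₁d
  set J₂ : Finset (Fin 3 → Fin L) := Finset.univ.filter fun b => ∃ y : T3,
    Torus.gridIndex L (Torus.repr y) = Torus.finIndex b ∧ R' + 2 / L < Torus.euclidDist y x₀ with hJ₂d
  have hJ₁ : ∀ b ∈ J₁, ∀ y' : T3, Torus.gridIndex L (Torus.repr y') = Torus.finIndex b →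
      Torus.euclidDist y' x₀ < R' := fun b hb y' hy' => by
    obtain ⟨y, hy, hd⟩ := (Finset.mem_filter.1 hb).2
    have h1 := Torus.euclidDist_triangle y' y x₀
    have h2 := euclidDist_le_of_gridIndex_eq hL hy' hy
    linarith
  have hJ₂ : ∀ b ∈ J₂, ∀ y' : T3, Torus.gridIndex L (Torus.repr y') = Torus.finIndex b →
      R' < Torus.euclidDist y' x₀ := fun b hb y' hy' => by
    obtain ⟨y, hy, hd⟩ := (Finset.mem_filter.1 hb).2
    have h1 := Torus.euclidDist_triangle y y' x₀
    have h2 := euclidDist_le_of_gridIndex_eq hL hy hy'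
    linarith
  have hJ : ∀ b ∈ J₁, b ∉ J₂ := fun b hb hb' => by
    obtain ⟨y, hy, hd⟩ := (Finset.mem_filter.1 hb).2
    have h1 := hJ₂ b hb' y hy
    have h2 : (0 : ℝ) ≤ 2 / L := by positivity
    linarith
  have h1 : (k : ℝ) ≤ J₁.card := hkB.trans (pow_mul_toReal_le_card hL
    fun y hy b hb => Finset.mem_filter.2 ⟨Finset.mem_univ _, y, hb, hy⟩)
  have h2 : ((n - k : ℕ) : ℝ) ≤ J₂.card := by
    rw [Nat.cast_sub hkn]
    exact hkE.trans (pow_mul_toReal_le_card hL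
      fun y hy b hb => Finset.mem_filter.2 ⟨Finset.mem_univ _, y, hb, hy⟩)
  exact exists_chargedSet hL hε x₀ R' hJ₁ hJ₂ hJ hkn (by exact_mod_cast h1) (by exact_mod_cast h2)

/-! ## Two analytic tools for the count window: the block mesh and continuity from below -/

/-- The block mesh `L = ⌊(2 ε_N)⁻¹⌋₊` (any `L` with `(2ε_N)⁻¹ - 1 < L ≤ (2ε_N)⁻¹`) at diameter
`ε_N = hsDiameter σ N ≤ 1/12` satisfies `L > 0`, `ε_N ≤ (2L)⁻¹`, `L³ ≥ (N+1)/(16σ³)` and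
`2/L ≤ 5 ε_N` (using `(N+1) ε_N³ = σ³`). -/
theorem mesh_spec {σ : ℝ} (hσ : 0 < σ) {N L : ℕ} (hε : hsDiameter σ N ≤ 1 / 12)
    (hL1 : (L : ℝ) ≤ 1 / (2 * hsDiameter σ N)) (hL2 : 1 / (2 * hsDiameter σ N) < (L : ℝ) + 1) :
    0 < L ∧ hsDiameter σ N ≤ ((2 * L : ℕ) : ℝ)⁻¹ ∧
      ((N : ℝ) + 1) / (16 * σ ^ 3) ≤ (L : ℝ) ^ 3 ∧ 2 / (L : ℝ) ≤ 5 * hsDiameter σ N := by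
  set ε := hsDiameter σ N with hεdef
  have hε0 : 0 < ε := hsDiameter_pos hσ N
  have hεne : ε ≠ 0 := hε0.ne'
  have hL3 : 5 / (12 * ε) ≤ (L : ℝ) := by
    have h1 : 5 / (12 * ε) ≤ 1 / (2 * ε) - 1 := by
      rw [div_le_iff₀ (by positivity : (0 : ℝ) < 12 * ε)]
      have : (1 / (2 * ε) - 1) * (12 * ε) = 6 - 12 * ε := by field_simp; ring
      rw [this]
      linarith
    linarith
  have hLpos : (0 : ℝ) < L := lt_of_lt_of_le (by positivity) hL3
  refine ⟨by exact_mod_cast hLpos, ?_, ?_, ?_⟩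
  · rw [show (((2 * L : ℕ) : ℝ)) = 2 * (L : ℝ) by push_cast; ring, inv_eq_one_div,
      le_div_iff₀ (by positivity)]
    have := (le_div_iff₀ (by positivity : (0 : ℝ) < 2 * ε)).1 hL1
    linarith
  · have hε3 : ((N : ℝ) + 1) * ε ^ 3 = σ ^ 3 := by
      have := succ_mul_hsDiameter_pow_three σ N
      push_cast at this
      exact this
    refine le_trans ?_ (pow_le_pow_left₀ (by positivity) hL3 3)
    rw [← hε3, div_le_iff₀ (by positivity)]
    have : (5 / (12 * ε)) ^ 3 * (16 * (((N : ℝ) + 1) * ε ^ 3)) = 2000 / 1728 * ((N : ℝ) + 1) := by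
      field_simp
      ring
    rw [this]
    have : (0 : ℝ) ≤ (N : ℝ) + 1 := by positivity
    linarith
  · rw [div_le_iff₀ hLpos]
    have h6 : 5 * ε * (5 / (12 * ε)) = 25 / 12 := by field_simp; ring
    nlinarith [mul_le_mul_of_nonneg_left hL3 (by positivity : (0 : ℝ) ≤ 5 * ε)]

/-- Continuity from below for strict sublevel sets: if `v < μ {f < R}` then `v < μ {f < R - s}`
for some `s > 0` (`{f < R} = ⋃ₙ {f < R - 1/(n+1)}` increasingly). -/
theorem exists_shrink {α : Type*} [MeasurableSpace α] (μ : Measure α) (f : α → ℝ) (R : ℝ)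
    {v : ℝ≥0∞} (hv : v < μ {y | f y < R}) : ∃ s : ℝ, 0 < s ∧ v < μ {y | f y < R - s} := by
  set S : ℕ → Set α := fun n => {y | f y < R - 1 / ((n : ℝ) + 1)} with hS
  have hmono : Monotone S := by
    intro a b hab y hy
    have hab' : (a : ℝ) + 1 ≤ (b : ℝ) + 1 := by exact_mod_cast Nat.add_le_add_right hab 1
    have h1 : (1 : ℝ) / ((b : ℝ) + 1) ≤ 1 / ((a : ℝ) + 1) :=
      one_div_le_one_div_of_le (by positivity) hab'
    simp only [hS, mem_setOf_eq] at hy ⊢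
    linarith
  have hU : (⋃ n, S n) = {y | f y < R} := by
    ext y
    simp only [mem_iUnion, hS, mem_setOf_eq]
    constructor
    · rintro ⟨n, hn⟩
      have : (0 : ℝ) < 1 / ((n : ℝ) + 1) := by positivity
      linarith
    · intro hy
      obtain ⟨n, hn⟩ := exists_nat_one_div_lt (sub_pos.2 hy)
      exact ⟨n, by linarith⟩
  have ht := tendsto_measure_iUnion_atTop (μ := μ) hmono
  rw [hU] at ht
  obtain ⟨n, hn⟩ := (ht.eventually_const_lt hv).exists
  exact ⟨1 / ((n : ℝ) + 1), by positivity, hn⟩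

end

end Summit.AtomisticToContinuum.HydrodynamicLimit.Theorems.LightConeInLawCSR.ChargedAtoms
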